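import Summits.Ventures.PercRepro.ProfilePointedContainment
import Summits.Ventures.PercRepro.ProfilePointedMirror

/-!
# PercRepro — (H) AS A CONTAINMENT MATCHING BETWEEN MIRROR LEVELS: THE CONJECTURE (H-SUP) (p10, gen 26)

For a finite matroid `M` on `N` elements and a point `p`, `𝒦_k = capLevel M p k` is the level-`k` slice of the captured
family (`κ_k = #𝒦_k`).  The mirror statement (H) `κ_k ≤ κ_{N−1−k}` for `2k + 2 ≤ N` (p5's `CapMirror`, equivalent to
the per-point form `out_k ≤ in_{k+1}` of Theorem A) has a natural STRUCTURAL strengthening, the mirror-level twin of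
gen 17's (SUP) (which paired `k` with `N − k` and was refuted at `N = 9`):

  (H-SUP)  for every `2k + 2 ≤ N` the containment graph `𝒦_k → 𝒦_{N−1−k}` (`X ⊆ X'`) has a matching saturating `𝒦_k`

(`CapMirrorSup`: an injection `f` on `𝒦_k` with `X ⊆ f X ∈ 𝒦_{N−1−k}`; `CapMirrorSupHall`: Hall's condition).  Proved
here: `CapMirrorSup ↔ CapMirrorSupHall` (Mathlib's Hall theorem), `CapMirrorSup → CapMirror` (hence, through
ProfilePointedMirrorLimit's `capLimitPlus_of_capMirror`, (C1″), and (D) at the middle level of an even ground set), and EVERY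
SOURCE HAS A TARGET
(`exists_mem_capLevel_mirror_superset`: a captured `k`-set extends inside `E − p` to a captured `(N−1−k)`-set, by gen 17's
superset closure).  CENSUS (gen 26, own code mining/p10/g26/): (H-SUP) holds at every level of every `(M, p)` with
`𝒦 ≠ ∅` on every matroid with ≤ 8 elements (1,932 level instances, 0 Hall failures), on the `n = 9` catalogue (kit
j297046: 2,602 instances, 9,697 sources, 0 failures) and on random GF(q) / graphic / sparse-paving matroids on 10–12
points (0 failures, including the consecutive middle pair `𝒦_4 → 𝒦_5` of `N = 10`).  Nothing here asserts (H-SUP), (H),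
(C1″) or (D).
-/

open scoped Matroid

namespace PercRepro.Cogirth

open Finset ThmH Skew

variable {α : Type} [DecidableEq α] {M : Matroid α} [M.Finite]

/-- **(H-SUP) (NOT asserted)**: for every finite matroid on `α`, every point `p` and every level `2k + 2 ≤ N`, the
containment graph `𝒦_k → 𝒦_{N−1−k}` has a matching saturating `𝒦_k` — an injection `f` on `𝒦_k` with
`X ⊆ f X ∈ 𝒦_{N−1−k}`. -/
def CapMirrorSup (α : Type) [DecidableEq α] : Prop :=
  ∀ (M : Matroid α) [M.Finite] (p : α) (k : ℕ), p ∈ gr M → 2 * k + 2 ≤ (gr M).card →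
    ∃ f : Finset α → Finset α, Set.InjOn f (capLevel M p k) ∧
      ∀ X ∈ capLevel M p k, f X ∈ capLevel M p ((gr M).card - (k + 1)) ∧ X ⊆ f X

/-- **(H-SUP), HALL FORM (NOT asserted)**: every subfamily `𝒜 ⊆ 𝒦_k` (`2k + 2 ≤ N`) has at least `#𝒜` captured
supersets at the mirror level `N − 1 − k`. -/
def CapMirrorSupHall (α : Type) [DecidableEq α] : Prop :=
  ∀ (M : Matroid α) [M.Finite] (p : α) (k : ℕ), p ∈ gr M → 2 * k + 2 ≤ (gr M).card →
    ∀ 𝒜 ⊆ capLevel M p k,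
      𝒜.card ≤ ((capLevel M p ((gr M).card - (k + 1))).filter (fun X' => ∃ X ∈ 𝒜, X ⊆ X')).card

/-- (H-SUP) ⟹ (H): the injection `𝒦_k → 𝒦_{N−1−k}` gives `κ_k ≤ κ_{N−1−k}`. -/
theorem capMirror_of_capMirrorSup (h : CapMirrorSup α) : CapMirror α := by
  intro M _ p k hp hk
  obtain ⟨f, hinj, hf⟩ := h M p k hp hk
  rw [← card_capLevel, ← card_capLevel]
  exact card_le_card_of_injOn f (fun X hX => (hf X hX).1) hinj

/-- (H-SUP) ⟹ the per-point form `out_k ≤ in_{k+1}` of Theorem A (p5's `BiIndepPointed`). -/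
theorem biIndepPointed_of_capMirrorSup (h : CapMirrorSup α) : BiIndepPointed α :=
  biIndepPointed_iff_capMirror.2 (capMirror_of_capMirrorSup h)

/-- The injection form of (H-SUP) gives the Hall form. -/
theorem capMirrorSupHall_of_capMirrorSup (h : CapMirrorSup α) : CapMirrorSupHall α := by
  intro M _ p k hp hk 𝒜 h𝒜
  obtain ⟨f, hinj, hf⟩ := h M p k hp hk
  apply card_le_card_of_injOn f
  · intro X hX
    have hX' : X ∈ 𝒜 := hX
    have hXk : X ∈ capLevel M p k := h𝒜 hX'
    rw [mem_coe, mem_filter]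
    exact ⟨(hf X hXk).1, X, hX', (hf X hXk).2⟩
  · exact hinj.mono (fun X hX => h𝒜 hX)

/-- The Hall form of (H-SUP) gives the injection form (Mathlib's Hall theorem on the subtype `𝒦_k`). -/
theorem capMirrorSup_of_capMirrorSupHall (h : CapMirrorSupHall α) : CapMirrorSup α := by
  intro M _ p k hp hk
  have hH := h M p k hp hk
  let T : Finset (Finset α) := capLevel M p ((gr M).card - (k + 1))
  let t : {X // X ∈ capLevel M p k} → Finset (Finset α) := fun X => T.filter (fun X' => X.1 ⊆ X')
  have hall : ∀ s : Finset {X // X ∈ capLevel M p k}, s.card ≤ (s.biUnion t).card := by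
    intro s
    have h1 := hH (s.map (Function.Embedding.subtype _)) (by
      intro X hX
      rw [mem_map] at hX
      obtain ⟨Y, _, rfl⟩ := hX
      exact Y.2)
    rw [card_map] at h1
    refine h1.trans (card_le_card ?_)
    intro X' hX'
    rw [mem_filter] at hX'
    obtain ⟨hX'T, Y, hY, hYX'⟩ := hX'
    rw [mem_map] at hY
    obtain ⟨Z, hZ, rfl⟩ := hY
    rw [mem_biUnion]
    refine ⟨Z, hZ, ?_⟩
    simp only [t, mem_filter]
    exact ⟨hX'T, hYX'⟩
  obtain ⟨f, hfinj, hft⟩ := (all_card_le_biUnion_card_iff_existsInjective' t).1 hall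
  refine ⟨fun X => if hX : X ∈ capLevel M p k then f ⟨X, hX⟩ else X, ?_, ?_⟩
  · intro X hX Y hY hXY
    have hX' : X ∈ capLevel M p k := hX
    have hY' : Y ∈ capLevel M p k := hY
    dsimp only at hXY
    rw [dif_pos hX', dif_pos hY'] at hXY
    exact congrArg Subtype.val (hfinj hXY)
  · intro X hX
    dsimp only
    rw [dif_pos hX]
    have h1 := hft ⟨X, hX⟩
    simp only [t, mem_filter] at h1
    exact h1

/-- (H-SUP) in its two forms is one statement. -/
theorem capMirrorSup_iff_capMirrorSupHall : CapMirrorSup α ↔ CapMirrorSupHall α :=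
  ⟨capMirrorSupHall_of_capMirrorSup, capMirrorSup_of_capMirrorSupHall⟩

/-- **EVERY SOURCE HAS A TARGET**: a captured `k`-set with `2k + 2 ≤ N` has a captured superset at the mirror level
`N − 1 − k` — gen 17's superset at level `N − k` minus one of its new elements, captured by the superset closure. -/
theorem exists_mem_capLevel_mirror_superset {p : α} {k : ℕ} (hk : 2 * k + 2 ≤ (gr M).card)
    {X : Finset α} (hX : X ∈ capLevel M p k) :
    ∃ X' ∈ capLevel M p ((gr M).card - (k + 1)), X ⊆ X' := by
  obtain ⟨X', hX', hXX'⟩ := exists_mem_capLevel_superset (M := M) (p := p) (k := k) (by omega) hX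
  rw [mem_capLevel] at hX hX'
  obtain ⟨hXK, hXk⟩ := hX
  obtain ⟨hX'K, hX'k⟩ := hX'
  obtain ⟨X'', hXX'', hX''X', hX''card⟩ :=
    exists_subsuperset_card_eq (n := (gr M).card - (k + 1)) hXX' (by omega) (by omega)
  refine ⟨X'', ?_, hXX''⟩
  rw [mem_capLevel]
  have hX'K' := hX'K
  rw [mem_capSets, mem_biIndepAll] at hX'K'
  obtain ⟨⟨⟨hX'g, hX'r, -⟩, hpX'⟩, -⟩ := hX'K'
  refine ⟨mem_capSets_of_subset hXK hXX'' (hX''X'.trans hX'g) (fun h => hpX' (hX''X' h))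
    (rk_eq_card_of_subset_of_rk_eq_card hX''X' hX'r), hX''card⟩

/-- In particular `κ_k > 0 ⟹ κ_{N−1−k} > 0` for `2k + 2 ≤ N`: no level of (H) is vacuously false. -/
theorem capCount_mirror_pred_pos {p : α} {k : ℕ} (hk : 2 * k + 2 ≤ (gr M).card)
    (h : 0 < capCount M k p) : 0 < capCount M ((gr M).card - (k + 1)) p := by
  rw [← card_capLevel, card_pos] at h ⊢
  obtain ⟨X, hX⟩ := h
  obtain ⟨X', hX', -⟩ := exists_mem_capLevel_mirror_superset hk hX
  exact ⟨X', hX'⟩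

end PercRepro.Cogirth
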